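import Mathlib
import Summits.ResolutionOfSingularities.ResolutionOfSingularities.Theorems.WeightedInvariantLocalWeightedDropMonicPointBlowup
import Summits.ResolutionOfSingularities.ResolutionOfSingularities.Theorems.WeightedInvariantLocalWeightedDropSpaceCountGameInvariance
import Summits.ResolutionOfSingularities.ResolutionOfSingularities.Theorems.WeightedInvariantLocalWeightedDropWildTerminalCalculus
import Summits.ResolutionOfSingularities.ResolutionOfSingularities.Theorems.WeightedInvariantLocalWeightedDropMonomialPhaseChart

/-!
# `WeightedInvariant.LocalWeightedDrop`, residual T″|₄ (skeleton v32, registered stub `stub_spaceNCRankDrop`): TOT2-LINE piece S-E2,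
# (E2-c) THE COUNT-GAME BRIDGE — the POINT MOVE on a dressed monic form

Crux item stmt-ResolutionOfSingularities-8899 `LocalWeightedDrop` (route `ResolutionOfSingularities/WeightedInvariant`); line TOT2-LINE v1 of
res-L1-w43-lead-1 (`L/res-L1-w43-lead-1/g4/TOT2-LINE.md` §5 (E2-c)), dealt to res-L1-w43-stub-2 (res-L1-w43-plan-1 DEALS gen 10 #9); READ-BACK
`L/res-L1-w43-stub-2/g4/S-E2c-READBACK.md` (c0)/(c1).  [OURS · L1 W4.3, chain w43, res-L1-w43-stub-2 (gen 4).  A port of the WEIGHTED-game brick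
`won_monic_of_pointBlowup` (…MonicPointBlowup: `transform_monic`, `coeff_top_g₀`, `constantCoeff_g₀`, `slice_g₀`) to the `MoveClause` of the NC COUNT
GAME (…SpaceCountGame); nothing here is a statement of any manuscript; AI-written, gate-accepted means sorry-free with standard axioms.  Definition-free.]

THE POSITION: a DRESSED MONIC FORM `b = U · P · ∏_{l ∈ L} x_l` in `k⟦x', y⟧` (`m` coefficient letters `x'`, `y = X (Fin.last m)`), `U(0) ≠ 0`,
`P = y^d + Σ_{j<d} A_j(x') y^j` with `ord A_j > d − j` (a positive label), `L` a set of boundary LETTERS.  THE MOVE: the point blow-up, no coordinate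
change (`Φ = X`, all weights `1`; preparation / Weierstrass / shears are composed in by the caller — `MoveClause b Φ w` only sees `b ∘ Φ`).
THE CLAUSE (`moveClause_point_dressedMonic`): at EVERY answer `pt ≠ 0` of the opponent and every `s`-saturation `b∘chart(pt) = s^A · G`, `s ∤ G`:
* if `γ = pt(y) ≠ 0` the mover takes the slot `y`: the successor `s · G|` is a UNIT times a square-free monomial in letters — `GermIsNC`, terminal
  (the weighted brick never visits these answers; here they are the trivial exits);
* if `γ = 0` the mover takes a live old slot `i₀` (`pt(x'_{i₀}) ≠ 0`): the successor is AGAIN A DRESSED MONIC FORM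
  `V · (y^d + Σ_j (s·B_j)|_{i₀} y^j) · (s · ∏_{l ∈ L, pt_l = 0} x_{l↓})` with `A_j ∘ chart(pt') = s^{d−j+1} B_j`, `V(0) ≠ 0`, the new exceptional
  letter `s = X 0` and the through-going old letters renamed by `Fin.predAbove` — exactly the data of the weighted brick's `hsucc`, so the slot
  identifications of …PolyDescentBridgeSlices (`slice_zero_eq_blowOneT`, `slice_one_eq_blowTwoT`) apply verbatim at `m = 2`.
Helpers: `not_X_zero_dvd_C_add_X_succ`, `slice_C_add_X_succ_of_ne`, `germIsNC_unit_mul_X_zero_mul_prod_X`, `transform_dressedMonic`.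
-/

set_option linter.dupNamespace false -- mandated namespace of this single-conjunct summit
set_option autoImplicit false

namespace Summit.ResolutionOfSingularities.ResolutionOfSingularities.Theorems

open Literature.AlgebraicGeometry.Resolution
open Literature.AlgebraicGeometry.Resolution.CobordantGame

namespace TameFourTupleDrop

open MvPowerSeries MonicPointBlowup

variable {k : Type} [Field k] {m : ℕ}

/-! ## Small algebra in the chart -/

/-- `s ∤ c + y_l` (`y_l = X l.succ`): its `y_l`-coefficient is `1`. -/
theorem not_X_zero_dvd_C_add_X_succ (a : k) (l : Fin (m + 1)) :
    ¬ (X 0 : MvPowerSeries (Fin (m + 1 + 1)) k) ∣ C a + X l.succ := by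
  intro h
  have h1 := (X_dvd_iff.mp h) (Finsupp.single l.succ 1) (by rw [Finsupp.single_apply, if_neg (Fin.succ_ne_zero l)])
  rw [map_add, coeff_C, if_neg (Finsupp.single_ne_zero.mpr one_ne_zero), zero_add, coeff_X, if_pos rfl] at h1
  exact one_ne_zero h1

/-- The slice `y_i ↦ 0` sends another letter `y_l`, `l ≠ i`, to the letter `x_{predAbove i l.succ}`. -/
theorem slice_X_succ_of_ne {i l : Fin (m + 1)} (h : l ≠ i) :
    TupleGame.slice i (X l.succ : MvPowerSeries (Fin (m + 1 + 1)) k) = X (Fin.predAbove i l.succ) := by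
  unfold TupleGame.slice
  rw [subst_X (CobordantChartPlaneSlice.hasSubst_slice i), if_neg (fun h' => h (Fin.succ_injective _ h'))]

/-- The slice of `c + y_l` at another slot: `c + x_{l↓}`. -/
theorem slice_C_add_X_succ_of_ne (a : k) {i l : Fin (m + 1)} (h : l ≠ i) :
    TupleGame.slice i (C a + X l.succ : MvPowerSeries (Fin (m + 1 + 1)) k) = C a + X (Fin.predAbove i l.succ) := by
  rw [WildTerminal.slice_add, WildTerminal.slice_C, slice_X_succ_of_ne h]

/-- The slice of `c + y_i` at its own slot is the constant `c`. -/
theorem slice_C_add_X_succ_self (a : k) (i : Fin (m + 1)) :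
    TupleGame.slice i (C a + X i.succ : MvPowerSeries (Fin (m + 1 + 1)) k) = C a := by
  rw [WildTerminal.slice_add, WildTerminal.slice_C, WildTerminal.slice_X_succ_self, add_zero]

/-- The slice is multiplicative over `Finset` products. -/
theorem slice_finset_prod {ι : Type} (i : Fin (m + 1)) (S : Finset ι) (f : ι → MvPowerSeries (Fin (m + 1 + 1)) k) :
    TupleGame.slice i (∏ l ∈ S, f l) = ∏ l ∈ S, TupleGame.slice i (f l) := by
  unfold TupleGame.slice
  rw [← coe_substAlgHom (CobordantChartPlaneSlice.hasSubst_slice (R := k) i), map_prod]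

/-- A product of letters indexed by anything is a monomial: `∏_{l ∈ S} x_{g l} = ∏_i x_i ^ #{l ∈ S : g l = i}`. -/
theorem prod_X_eq_prod_X_pow {n : ℕ} {ι : Type} (S : Finset ι) (g : ι → Fin n) :
    ∏ l ∈ S, (X (g l) : MvPowerSeries (Fin n) k) = ∏ i : Fin n, X i ^ (S.filter (fun l => g l = i)).card := by
  classical
  rw [Finset.prod_comp]
  refine (Finset.prod_subset (Finset.subset_univ _) fun i _ hi => ?_).symm.trans (Finset.prod_congr rfl fun i _ => rfl) |>.symm.trans ?_
  · rw [Finset.filter_eq_empty_iff.mpr (fun l hl hgl => hi (Finset.mem_image.mpr ⟨l, hl, hgl⟩)), Finset.card_empty, pow_zero]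
  · rfl

/-- **A unit times `s` times a product of letters has normal-crossing support** (identity coordinates). -/
theorem germIsNC_unit_mul_X_zero_mul_prod_X {ι : Type} (S : Finset ι) (g : ι → Fin (m + 1)) (V : MvPowerSeries (Fin (m + 1)) k)
    (hV : constantCoeff V ≠ 0) : GermIsNC (V * (X 0 * ∏ l ∈ S, X (g l))) := by
  classical
  refine TupleMonomialPhase.germIsNC_of_unitMonomial ⟨V, fun i => (if i = 0 then 1 else 0) + (S.filter (fun l => g l = i)).card, hV, ?_⟩
  congr 1
  rw [prod_X_eq_prod_X_pow S g]
  simp only [pow_add, Finset.prod_mul_distrib, pow_ite, pow_one, pow_zero, Finset.prod_ite_eq', Finset.mem_univ, if_true]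

/-! ## The transform of a dressed monic form under the point blow-up -/

/-- THE TOTAL TRANSFORM of `U · P · ∏_{l∈L} x_l` at the answer `pt`, given `A_j ∘ chart(pt') = s^{d−j+1} B_j`:
`s^{d + #L} · (U∘chart · g₀ · ∏_{l∈L} (pt_l + y_l))` with `g₀ = (γ + Y)^d + s · Σ_j B_j (γ + Y)^j`. -/
theorem transform_dressedMonic {d : ℕ} (A : Fin d → MvPowerSeries (Fin m) k) (U : MvPowerSeries (Fin (m + 1)) k) (L : Finset (Fin (m + 1)))
    (pt : Fin (m + 1) → k) (B : Fin d → MvPowerSeries (Fin (m + 1)) k)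
    (hB : ∀ j, subst (CobordantChart.chart (fun _ : Fin m => 1) (fun i => pt (Fin.castSucc i))) (A j) = X 0 ^ (d - (j : ℕ) + 1) * B j) :
    subst (CobordantChart.chart (fun _ : Fin (m + 1) => 1) pt)
        (U * (X (Fin.last m) ^ d + ∑ j : Fin d, rename (Fin.succAboveEmb (Fin.last m)) (A j) * X (Fin.last m) ^ (j : ℕ)) * ∏ l ∈ L, X l) =
      X 0 ^ (d + L.card) * (subst (CobordantChart.chart (fun _ : Fin (m + 1) => 1) pt) U *
        ((C (pt (Fin.last m)) + X (Fin.last (m + 1))) ^ d +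
          X 0 * ∑ j : Fin d, rename (Fin.succAboveEmb (Fin.last (m + 1))) (B j) * (C (pt (Fin.last m)) + X (Fin.last (m + 1))) ^ (j : ℕ)) *
        ∏ l ∈ L, (C (pt l) + X l.succ)) := by
  have hch := CobordantChart.hasSubst_chart (fun _ : Fin (m + 1) => 1) pt (fun i hi => absurd hi one_ne_zero)
  have hT := transform_monic A pt B hB
  rw [cruxChart_one_eq_chart] at hT
  rw [← coe_substAlgHom hch, map_mul, map_mul, map_prod, coe_substAlgHom, hT]
  have hl : ∀ l ∈ L, subst (CobordantChart.chart (fun _ : Fin (m + 1) => 1) pt) (X l : MvPowerSeries (Fin (m + 1)) k) =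
      X 0 * (C (pt l) + X l.succ) := fun l _ => by
    rw [subst_X hch, CobordantChart.chart_apply, pow_one]
  rw [Finset.prod_congr rfl hl, Finset.prod_mul_distrib, Finset.prod_const, pow_add]
  ring

/-- The bracket of the transform is not divisible by `s`. -/
theorem not_X_zero_dvd_bracket {d : ℕ} (U : MvPowerSeries (Fin (m + 1)) k) (hU : constantCoeff U ≠ 0) (L : Finset (Fin (m + 1)))
    (pt : Fin (m + 1) → k) (R : MvPowerSeries (Fin (m + 1 + 1)) k) :
    ¬ (X 0 : MvPowerSeries (Fin (m + 1 + 1)) k) ∣ subst (CobordantChart.chart (fun _ : Fin (m + 1) => 1) pt) U *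
        ((C (pt (Fin.last m)) + X (Fin.last (m + 1))) ^ d + X 0 * R) * ∏ l ∈ L, (C (pt l) + X l.succ) := by
  classical
  have hprime := MvPowerSeries.prime_X' k (0 : Fin (m + 1 + 1))
  have hU' : constantCoeff (subst (CobordantChart.chart (fun _ : Fin (m + 1) => 1) pt) U) ≠ 0 := by
    rw [constantCoeff_subst_of_constantCoeff_zero _ (CobordantArc.constantCoeff_chart _ pt (fun i hi => absurd hi one_ne_zero)) U]
    exact hU
  have hg₀ : ¬ (X 0 : MvPowerSeries (Fin (m + 1 + 1)) k) ∣ (C (pt (Fin.last m)) + X (Fin.last (m + 1))) ^ d + X 0 * R := fun h => by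
    have h1 := coeff_top_g₀ (m := m) d (pt (Fin.last m)) R
    rw [X_dvd_iff.mp h _ (by rw [Finsupp.single_apply, if_neg Fin.last_pos.ne'])] at h1
    exact zero_ne_one h1
  intro h
  rcases hprime.dvd_or_dvd h with h | h
  · rcases hprime.dvd_or_dvd h with h | h
    · exact not_X_dvd_of_constantCoeff_ne_zero hU' h
    · exact hg₀ h
  · obtain ⟨l, -, hl⟩ := (hprime.dvd_finsetProd_iff _).mp h
    exact not_X_zero_dvd_C_add_X_succ (pt l) l hl

/-! ## The move clause -/

open scoped Classical in
/-- **(E2-c), POINT MOVE — THE COUNT-GAME BRIDGE ON A DRESSED MONIC FORM.**  For `U(0) ≠ 0`, a positive label `A` (`ord A_j > d − j`) and a set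
`L` of boundary letters, the point blow-up (`Φ = X`, all weights `1`) satisfies the `MoveClause` with the goodness predicate «terminal (`GermIsNC`)
OR again a dressed monic form one blow-up later»: at an answer with `γ = pt(y) ≠ 0` the successor at the slot `y` is a unit times `s` times letters;
at `γ = 0` the successor at a live old slot `i₀` is `V · (y^d + Σ_j (s·B_j)|_{i₀} y^j) · (s · ∏_{l ∈ L, pt_l = 0} x_{l↓})` with
`A_j ∘ chart(pt') = s^{d−j+1} B_j` (the weighted brick's successor data) and `V(0) ≠ 0`. [OURS · L1 W4.3] -/
theorem moveClause_point_dressedMonic {d : ℕ} (A : Fin d → MvPowerSeries (Fin m) k)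
    (hA : ∀ j : Fin d, ((d - (j : ℕ) : ℕ) : ℕ∞) < (A j).order) (U : MvPowerSeries (Fin (m + 1)) k) (hU : constantCoeff U ≠ 0)
    (L : Finset (Fin (m + 1))) :
    MoveClause (U * (X (Fin.last m) ^ d + ∑ j : Fin d, rename (Fin.succAboveEmb (Fin.last m)) (A j) * X (Fin.last m) ^ (j : ℕ)) * ∏ l ∈ L, X l)
      X (fun _ => 1)
      (fun b' => GermIsNC b' ∨
        ∃ (pt : Fin (m + 1) → k) (i₀ : Fin m) (B : Fin d → MvPowerSeries (Fin (m + 1)) k) (V : MvPowerSeries (Fin (m + 1)) k),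
          pt (Fin.last m) = 0 ∧ pt (Fin.castSucc i₀) ≠ 0 ∧
          (∀ j, subst (CobordantChart.chart (fun _ : Fin m => 1) (fun i => pt (Fin.castSucc i))) (A j) = X 0 ^ (d - (j : ℕ) + 1) * B j) ∧
          constantCoeff V ≠ 0 ∧
          b' = V * (X (Fin.last m) ^ d +
              ∑ j : Fin d, rename (Fin.succAboveEmb (Fin.last m)) (TupleGame.slice i₀ (X 0 * B j)) * X (Fin.last m) ^ (j : ℕ)) *
            (X 0 * ∏ l ∈ L.filter (fun l => pt l = 0), X (Fin.predAbove (Fin.castSucc i₀) l.succ))) := by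
  classical
  intro pt _ hpt0 A' G hfac hG
  set P : MvPowerSeries (Fin (m + 1)) k := X (Fin.last m) ^ d +
    ∑ j : Fin d, rename (Fin.succAboveEmb (Fin.last m)) (A j) * X (Fin.last m) ^ (j : ℕ) with hP
  have hself : subst (X : Fin (m + 1) → MvPowerSeries (Fin (m + 1)) k) (U * P * ∏ l ∈ L, X l) = U * P * ∏ l ∈ L, X l := by
    rw [subst_self]; rfl
  rw [hself] at hfac
  -- the factorisations `A_j ∘ chart(pt') = s^{d-j+1} B_j`
  set c : Fin m → k := fun i => pt (Fin.castSucc i) with hc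
  have hBex : ∀ j : Fin d, ∃ Bj : MvPowerSeries (Fin (m + 1)) k,
      subst (CobordantChart.chart (fun _ : Fin m => 1) c) (A j) = X 0 ^ (d - (j : ℕ) + 1) * Bj := fun j =>
    exists_eq_X_pow_mul_of_le_order c (A j) _ (Order.add_one_le_of_lt (hA j))
  choose B hB using hBex
  -- the transform and its bracket
  set γ : k := pt (Fin.last m) with hγ
  set R : MvPowerSeries (Fin (m + 1 + 1)) k :=
    ∑ j : Fin d, rename (Fin.succAboveEmb (Fin.last (m + 1))) (B j) * (C γ + X (Fin.last (m + 1))) ^ (j : ℕ) with hR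
  set Uc : MvPowerSeries (Fin (m + 1 + 1)) k := subst (CobordantChart.chart (fun _ : Fin (m + 1) => 1) pt) U with hUc
  set G₀ : MvPowerSeries (Fin (m + 1 + 1)) k := Uc * ((C γ + X (Fin.last (m + 1))) ^ d + X 0 * R) * ∏ l ∈ L, (C (pt l) + X l.succ)
    with hG₀
  have hT : subst (CobordantChart.chart (fun _ : Fin (m + 1) => 1) pt) (U * P * ∏ l ∈ L, X l) = X 0 ^ (d + L.card) * G₀ := by
    rw [hG₀, hUc, hR, hγ, hP]; exact transform_dressedMonic A U L pt B hB
  have hG₀ndvd : ¬ X 0 ∣ G₀ := by rw [hG₀, hUc]; exact not_X_zero_dvd_bracket U hU L pt R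
  rw [hT] at hfac
  obtain ⟨-, hGG⟩ := X_pow_mul_eq_X_pow_mul 0 hfac hG₀ndvd hG
  subst hGG
  -- units surviving the slices
  have hUc0 : constantCoeff Uc ≠ 0 := by
    rw [hUc, constantCoeff_subst_of_constantCoeff_zero _ (CobordantArc.constantCoeff_chart _ pt (fun i hi => absurd hi one_ne_zero)) U]
    exact hU
  by_cases hγ0 : γ = 0
  swap
  · -- `γ ≠ 0`: the slot `y`; the successor is a unit times `s` times the through-going letters
    refine ⟨Fin.last m, hγ0, Or.inl ?_⟩
    set i : Fin (m + 1) := Fin.last m with hi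
    have hsplit : ∏ l ∈ L, TupleGame.slice i (C (pt l) + X l.succ : MvPowerSeries (Fin (m + 1 + 1)) k) =
        (∏ l ∈ L.filter (fun l => pt l ≠ 0), TupleGame.slice i (C (pt l) + X l.succ)) *
          ∏ l ∈ L.filter (fun l => pt l = 0), X (Fin.predAbove i l.succ) := by
      rw [← Finset.prod_filter_mul_prod_filter_not L (fun l => pt l ≠ 0)]
      congr 1
      refine Finset.prod_congr (by ext l; simp) fun l hl => ?_
      have hl0 : pt l = 0 := by simpa using (Finset.mem_filter.mp hl).2
      have hli : l ≠ i := fun h => hγ0 (by rw [hγ]; exact h ▸ hl0)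
      rw [hl0, map_zero, zero_add, slice_X_succ_of_ne hli]
    set W : MvPowerSeries (Fin (m + 1)) k := TupleGame.slice i Uc * TupleGame.slice i ((C γ + X (Fin.last (m + 1))) ^ d + X 0 * R) *
      ∏ l ∈ L.filter (fun l => pt l ≠ 0), TupleGame.slice i (C (pt l) + X l.succ) with hW
    have hW0 : constantCoeff W ≠ 0 := by
      rw [hW, map_mul, map_mul, WildTerminal.constantCoeff_slice, WildTerminal.constantCoeff_slice, constantCoeff_g₀, map_prod]
      refine mul_ne_zero (mul_ne_zero hUc0 (pow_ne_zero d hγ0)) (Finset.prod_ne_zero_iff.mpr fun l hl => ?_)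
      rw [WildTerminal.constantCoeff_slice, map_add, constantCoeff_C, constantCoeff_X, add_zero]
      simpa using (Finset.mem_filter.mp hl).2
    have heq : X 0 * TupleGame.slice i G₀ = W * (X 0 * ∏ l ∈ L.filter (fun l => pt l = 0), X (Fin.predAbove i l.succ)) := by
      rw [hG₀, slice_mul, slice_mul, slice_finset_prod, hsplit, hW]; ring
    rw [heq]
    exact germIsNC_unit_mul_X_zero_mul_prod_X _ _ W hW0
  · -- `γ = 0`: a live old slot `i₀`; the successor is again a dressed monic form
    obtain ⟨i₀, hci₀⟩ : ∃ i₀ : Fin m, c i₀ ≠ 0 := by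
      by_contra! hnone
      apply hpt0
      funext l
      rcases Fin.eq_castSucc_or_eq_last l with ⟨i, rfl⟩ | rfl
      · exact hnone i
      · exact hγ0
    set i : Fin (m + 1) := Fin.castSucc i₀ with hi
    refine ⟨i, hci₀, Or.inr ⟨pt, i₀, B, TupleGame.slice i Uc * ∏ l ∈ L.filter (fun l => pt l ≠ 0), TupleGame.slice i (C (pt l) + X l.succ),
      hγ0, hci₀, hB, ?_, ?_⟩⟩
    · rw [map_mul, WildTerminal.constantCoeff_slice, map_prod]
      refine mul_ne_zero hUc0 (Finset.prod_ne_zero_iff.mpr fun l hl => ?_)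
      rw [WildTerminal.constantCoeff_slice, map_add, constantCoeff_C, constantCoeff_X, add_zero]
      simpa using (Finset.mem_filter.mp hl).2
    · have hsplit : ∏ l ∈ L, TupleGame.slice i (C (pt l) + X l.succ : MvPowerSeries (Fin (m + 1 + 1)) k) =
          (∏ l ∈ L.filter (fun l => pt l ≠ 0), TupleGame.slice i (C (pt l) + X l.succ)) *
            ∏ l ∈ L.filter (fun l => pt l = 0), X (Fin.predAbove i l.succ) := by
        rw [← Finset.prod_filter_mul_prod_filter_not L (fun l => pt l ≠ 0)]
        congr 1
        refine Finset.prod_congr (by ext l; simp) fun l hl => ?_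
        have hl0 : pt l = 0 := by simpa using (Finset.mem_filter.mp hl).2
        have hli : l ≠ i := fun h => hci₀ (by rw [hc]; show pt i = 0; exact h ▸ hl0)
        rw [hl0, map_zero, zero_add, slice_X_succ_of_ne hli]
      have hg₀ : TupleGame.slice i ((C γ + X (Fin.last (m + 1))) ^ d + X 0 * R) = X (Fin.last m) ^ d +
          ∑ j : Fin d, rename (Fin.succAboveEmb (Fin.last m)) (TupleGame.slice i₀ (X 0 * B j)) * X (Fin.last m) ^ (j : ℕ) := by
        rw [hR, hγ0]
        exact slice_g₀ i₀ B
      rw [hG₀, slice_mul, slice_mul, slice_finset_prod, hsplit, hg₀, hi]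
      ring

open scoped Classical in
/-- **THE SAME WITH A PREPARATORY COORDINATE CHANGE COMPOSED IN** (there are no free moves in the count game): if a legal `Φ₀` (zero constants)
presents `b ∘ Φ₀` as a dressed monic form `U · P · ∏_{l∈L} x_l` (Weierstrass form, shear, re-preparation `y ↦ y + ψ(x')` — the caller's choice),
then the move `(Φ₀, (1,…,1))` satisfies the same clause (`moveClause_subst_iff`). [OURS · L1 W4.3] -/
theorem moveClause_point_of_subst_eq_dressedMonic {d : ℕ} (A : Fin d → MvPowerSeries (Fin m) k)
    (hA : ∀ j : Fin d, ((d - (j : ℕ) : ℕ) : ℕ∞) < (A j).order) (U : MvPowerSeries (Fin (m + 1)) k) (hU : constantCoeff U ≠ 0)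
    (L : Finset (Fin (m + 1))) {b : MvPowerSeries (Fin (m + 1)) k} {Φ₀ : Fin (m + 1) → MvPowerSeries (Fin (m + 1)) k}
    (hΦ₀ : ∀ i, constantCoeff (Φ₀ i) = 0)
    (hb : subst Φ₀ b = U * (X (Fin.last m) ^ d + ∑ j : Fin d, rename (Fin.succAboveEmb (Fin.last m)) (A j) * X (Fin.last m) ^ (j : ℕ)) *
      ∏ l ∈ L, X l) :
    MoveClause b Φ₀ (fun _ => 1)
      (fun b' => GermIsNC b' ∨
        ∃ (pt : Fin (m + 1) → k) (i₀ : Fin m) (B : Fin d → MvPowerSeries (Fin (m + 1)) k) (V : MvPowerSeries (Fin (m + 1)) k),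
          pt (Fin.last m) = 0 ∧ pt (Fin.castSucc i₀) ≠ 0 ∧
          (∀ j, subst (CobordantChart.chart (fun _ : Fin m => 1) (fun i => pt (Fin.castSucc i))) (A j) = X 0 ^ (d - (j : ℕ) + 1) * B j) ∧
          constantCoeff V ≠ 0 ∧
          b' = V * (X (Fin.last m) ^ d +
              ∑ j : Fin d, rename (Fin.succAboveEmb (Fin.last m)) (TupleGame.slice i₀ (X 0 * B j)) * X (Fin.last m) ^ (j : ℕ)) *
            (X 0 * ∏ l ∈ L.filter (fun l => pt l = 0), X (Fin.predAbove (Fin.castSucc i₀) l.succ))) := by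
  have h := moveClause_point_dressedMonic A hA U hU L (k := k)
  rw [← hb, moveClause_subst_iff hΦ₀ (fun i => constantCoeff_X i)] at h
  have hΦ : (fun i => subst (X : Fin (m + 1) → MvPowerSeries (Fin (m + 1)) k) (Φ₀ i)) = Φ₀ := by
    funext i; rw [subst_self]; rfl
  rwa [hΦ] at h

end TameFourTupleDrop

end Summit.ResolutionOfSingularities.ResolutionOfSingularities.Theorems
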